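import Literature.NumberTheory.Sieve.MoebiusShiftedPrimesLiouville
import Literature.NumberTheory.Sieve.RamanujanSum
import HarnessLib

/-!
# Möbius on shifted primes — the circle-method dissection (Lichtman 2020, §3)

Topic `Literature/NumberTheory/Sieve`, fourth layer of the decomposition of the named fact
`Literature.NumberTheory.Sieve.lichtman2020_moebius_shifted_primes_avg` (J. D. Lichtman, *Averages of the Möbius function on
shifted primes*, Q. J. Math. (2021), doi:10.1093/qmath/haab054, arXiv:2009.08969 [Lichtman2020],
Theorem 1.1, qualitative part), after `MoebiusShiftedPrimesProofs.lean` (Thm 1.1 ⇐ Thm 2.2 + (2.5)),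
`MoebiusShiftedPrimesSieveBound.lean` ((2.5) proved) and `MoebiusShiftedPrimesLiouville.lean`
(Thm 2.2 ⇐ Prop 2.3).  Page numbers refer to the held copy `paper:arxiv-2009.08969`.

## Content

* `twistedSum g s α = ∑_{n ∈ s} g(n) e(nα)`; the major arcs `lichtmanMajorArc Q₁ q = 𝔐(q)`,
  `lichtmanMajorArcs W Q₁ = 𝔐 = ⋃_{q ≤ W} 𝔐(q)` and minor arcs `lichtmanMinorArcs W Q₁ = [0,1] ∖ 𝔐`
  of p. 9 — DEFINITIONS.
* `Lichtman2020_minorArcEstimate` — NAMED FACT: Proposition 3.1 (key minor arc estimate, any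
  completely multiplicative `|g| ≤ 1`), p. 9.
* `Lichtman2020_majorArcEstimate` — NAMED FACT: Proposition 3.2 (key major arc estimate for `λ`), p. 9.
* `Lichtman2020_keyFourierEstimateLiouville'` — NAMED FACT: Proposition 2.3 in the regime
  `H ≤ exp((log X)^{2/3})` (weaker than the printed Prop 2.3 = `Lichtman2020_keyFourierEstimateLiouville`,
  see `Lichtman2020_keyFourierEstimateLiouville'_of_keyFourierEstimateLiouville`).
* PROVED: `Lichtman2020_keyFourierEstimateLiouville'_of_arcs` (Prop 3.1 + Prop 3.2 ⟹ Prop 2.3 in the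
  regime; p. 9 "We shall obtain Proposition 2.3 from the following results": periodicity reduces
  `α ∈ ℝ` to `[0,1] = 𝔐 ∪ 𝔪`, then `g = λ` on `𝔪` and `HX/(dW) ≤ HX/(d^{3/4}W^{1/5})` on `𝔐`);
  `Lichtman2020_keyFourierEstimate_of_liouville'` (Prop 2.3 in the regime ⟹ Thm 2.2, the argument of
  `MoebiusShiftedPrimesLiouville.lean` run from the weaker fact); and the composite
  `lichtman2020_moebius_shifted_primes_avg_of_arcs : Prop 3.1 → Prop 3.2 → (2.5) → Thm 1.1 (qualitative)`
  (feed `(2.5)` with `Lichtman2020_shiftedPrimeSieveBound_holds` of `MoebiusShiftedPrimesSieveBound.lean`,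
  not imported here).

## Two deviations from the letter of Propositions 3.1/3.2 (documented at the facts)

* The regime.  Props 2.3, 3.1, 3.2 are printed with "`ψ(X) ≤ (log X)^{2/3}`" (`H = (log X)^{ψ(X)}`),
  whereas the proofs run under the standing assumption "Hence we may assume `H ≤ exp((log X)^{2/3})`
  hereafter … in this case `Q₁ < P₂` so the intervals `[P_j,Q_j]` are disjoint" (p. 8), which §3.1
  uses (`𝟙_{S^{(1)}_d}(mp) = 𝟙_{S^{(1)}_d}(m)` for `p ≤ Q₁ < P₂`).  The facts of this file record the
  regime `H ≤ exp((log X)^{2/3})`; as a hypothesis it is stronger (the facts are weaker) and it is the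
  regime in which Theorem 2.2 is recorded and used.
* The set in Proposition 3.1.  Printed: `S_d(X,A,0)`; used on p. 9 for Prop 2.3: `S_d(X,A,δ)`;
  proved in §3.1 verbatim for every `δ ≥ 0` (the interval `[P₂,Q₂]` only enters through
  `𝟙_{S^{(1)}_d} ≤ 1` in the Ramaré identity (3.2)).  Recorded for all `δ ≥ 0`.

## Source

* J. D. Lichtman, *Averages of the Möbius function on shifted primes*, arXiv:2009.08969, §2 p. 8
  (regime, `S_d`), §3 p. 9 (arcs, Propositions 3.1, 3.2, deduction of Proposition 2.3).
-/

namespace Literature.NumberTheory.Sieve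

open Filter Asymptotics Finset MeasureTheory
open scoped FourierTransform Topology

/-! ### The circle-method dissection of Lichtman 2020, §3 -/

/-- The general twisted sum `∑_{n ∈ s} g(n) e(nα)` for `g : ℕ → ℂ`. [cite: Lichtman2020, Proposition 3.1] -/
noncomputable def twistedSum (g : ℕ → ℂ) (s : Finset ℕ) (α : ℝ) : ℂ :=
  ∑ n ∈ s, g n * (𝐞 (n * α) : ℂ)

/-- **The major arc around denominator `q`** (p. 9): "`𝔐(q) = ⋃_{(a,q)=1} {α : |α - a/q| ≤ 1/(qQ₁)}`"
(`a` ranges over the integers coprime to `q`). [cite: Lichtman2020, §3, p. 9] -/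
def lichtmanMajorArc (Q₁ : ℝ) (q : ℕ) : Set ℝ :=
  ⋃ (a : ℤ) (_ : Int.gcd a q = 1), {α : ℝ | |α - a / q| ≤ 1 / (q * Q₁)}

/-- **The major arcs** (p. 9): "`𝔐 = ⋃_{q ≤ W} 𝔐(q)`" (`q ≥ 1`; in the paper `W = (log X)^A` and
`Q₁ = (log X)^{ψ(X) - 4A} = H/W⁴`, cf. (2.3)). [cite: Lichtman2020, §3, p. 9] -/
def lichtmanMajorArcs (W Q₁ : ℝ) : Set ℝ :=
  ⋃ (q : ℕ) (_ : 1 ≤ q ∧ (q : ℝ) ≤ W), lichtmanMajorArc Q₁ q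

/-- **The minor arcs** (p. 9): "`𝔪 = [0,1] ∖ 𝔐`". [cite: Lichtman2020, §3, p. 9] -/
def lichtmanMinorArcs (W Q₁ : ℝ) : Set ℝ :=
  Set.Icc 0 1 \ lichtmanMajorArcs W Q₁

/-- `[0,1] ⊆ 𝔐 ∪ 𝔪`. [folklore] -/
theorem mem_majorArcs_or_minorArcs {W Q₁ α : ℝ} (h : α ∈ Set.Icc (0 : ℝ) 1) :
    α ∈ lichtmanMajorArcs W Q₁ ∨ α ∈ lichtmanMinorArcs W Q₁ := by
  by_cases hM : α ∈ lichtmanMajorArcs W Q₁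
  · exact Or.inl hM
  · exact Or.inr ⟨h, hM⟩

/-- NAMED FACT — **Lichtman 2020, Proposition 3.1 (key minor arc estimate)**, as printed (p. 9):
"Given any `A > 5`, `H = (log X)^{ψ(X)}` with `ψ(X) → ∞` and `ψ(X) ≤ (log X)^{2/3}`, let
`d ≤ W = (log X)^A` and `S_d = S_d(X,A,0)` as in (2.8). Then for any completely multiplicative
`g : ℕ → ℂ` with `|g| ≤ 1`, we have
`sup_{α ∈ 𝔪} ∫_0^X |∑_{x ≤ nd ≤ x+H, n ∈ S_d} g(n) e(nα)| dx ≪_A HX/(d^{3/4} W^{1/5})`."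
Rendering and TWO DOCUMENTED DEVIATIONS.  (i) The set: printed for `S_d(X,A,0)`; recorded for
`S_d(X,A,δ)` with `δ ≥ 0` arbitrary (the printed case is `δ = 0`), because this is how the
proposition is used on p. 9 ("We shall obtain Proposition 2.3 [stated for `S_d(X,A,δ)`] from the
following results") and what its proof (§3.1, pp. 9–10) establishes verbatim: the second interval
`[P₂,Q₂]` enters only through the indicator `𝟙_{S^{(1)}_d} ≤ 1` in the Ramaré identity (3.2).
(ii) The regime: printed "`ψ(X) ≤ (log X)^{2/3}`"; recorded as the standing assumption
"`H ≤ exp((log X)^{2/3})` hereafter" of p. 8 (under which `Q₁ < P₂`, used in §3.1), which is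
STRONGER as a hypothesis (so the fact is weaker) and is the regime in which Theorem 2.2 is recorded
(`Lichtman2020_keyFourierEstimate`).  Otherwise as for Proposition 2.3
(`Lichtman2020_keyFourierEstimateLiouville`): `X : ℕ`, `H : ℕ → ℕ`, window `Icc ⌈x/d⌉₊ ⌊(x+H)/d⌋₊`,
`S_d` = `lichtmanTypical X A δ (H X)` on `n`; `𝔪 = lichtmanMinorArcs W Q₁` with `W = (log X)^A`,
`Q₁ = H/(log X)^{4A}`; "completely multiplicative with `|g| ≤ 1`" = `g 1 = 1`, `g(mn) = g(m)g(n)`,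
`‖g n‖ ≤ 1`; "`≪_A`" (uniform in `d`, `g`, `α`) = `∃ C, ∀ᶠ X, ∀ d g α`, where `C` is chosen
after `δ` and the function `H` and so may depend on them as well (weaker than the printed `≪_A`;
harmless for the qualitative Theorem 1.1).
Users take `(h : Lichtman2020_minorArcEstimate)`. [cite: Lichtman2020, Proposition 3.1] -/
def Lichtman2020_minorArcEstimate : Prop :=
  ∀ A : ℝ, 5 < A → ∀ δ : ℝ, 0 ≤ δ → ∀ H : ℕ → ℕ,
    Tendsto (fun X : ℕ => Real.log (H X) / Real.log (Real.log X)) atTop atTop →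
    (∀ᶠ X : ℕ in atTop, (H X : ℝ) ≤ Real.exp (Real.log X ^ (2 / 3 : ℝ))) →
    ∃ C : ℝ, ∀ᶠ X : ℕ in atTop, ∀ d : ℕ, 1 ≤ d → (d : ℝ) ≤ Real.log X ^ A →
      ∀ g : ℕ → ℂ, g 1 = 1 → (∀ m n : ℕ, g (m * n) = g m * g n) → (∀ n : ℕ, ‖g n‖ ≤ 1) →
      ∀ α ∈ lichtmanMinorArcs (Real.log X ^ A) ((H X : ℝ) / Real.log X ^ (4 * A)),
        ∫ x in (0 : ℝ)..X,
            ‖twistedSum g ((Icc ⌈x / d⌉₊ ⌊(x + H X) / d⌋₊).filter (lichtmanTypical X A δ (H X))) α‖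
          ≤ C * ((H X : ℝ) * X / ((d : ℝ) ^ (3 / 4 : ℝ) * Real.log X ^ (A / 5)))

/-- NAMED FACT — **Lichtman 2020, Proposition 3.2 (key major arc estimate for `λ`)**, as printed
(p. 9): "Given any `A > 5`, `δ > 0`, `H = (log X)^{ψ(X)}` with `ψ(X) → ∞` and `ψ(X) ≤ (log X)^{2/3}`,
let `d ≤ W = (log X)^A` and `S_d = S_d(X,A,δ)` as in (2.8). Then we have
`sup_{α ∈ 𝔐} ∫_0^X |∑_{x ≤ nd ≤ x+H, n ∈ S_d} λ(n) e(nα)| dx ≪_{A,δ} HX/(dW)`."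
Rendering as for Proposition 3.1 above (deviation (ii) only: the regime "`ψ(X) ≤ (log X)^{2/3}`" is
recorded as "`H ≤ exp((log X)^{2/3})`", p. 8); `𝔐 = lichtmanMajorArcs W Q₁`, `W = (log X)^A`,
`Q₁ = H/(log X)^{4A}`; `C` is chosen after the function `H` and may depend on it (weaker than the
printed `≪_{A,δ}`).  Users take `(h : Lichtman2020_majorArcEstimate)`.
[cite: Lichtman2020, Proposition 3.2] -/
def Lichtman2020_majorArcEstimate : Prop :=
  ∀ A : ℝ, 5 < A → ∀ δ : ℝ, 0 < δ → ∀ H : ℕ → ℕ,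
    Tendsto (fun X : ℕ => Real.log (H X) / Real.log (Real.log X)) atTop atTop →
    (∀ᶠ X : ℕ in atTop, (H X : ℝ) ≤ Real.exp (Real.log X ^ (2 / 3 : ℝ))) →
    ∃ C : ℝ, ∀ᶠ X : ℕ in atTop, ∀ d : ℕ, 1 ≤ d → (d : ℝ) ≤ Real.log X ^ A →
      ∀ α ∈ lichtmanMajorArcs (Real.log X ^ A) ((H X : ℝ) / Real.log X ^ (4 * A)),
        ∫ x in (0 : ℝ)..X,
            ‖liouvilleTwistedSum
                ((Icc ⌈x / d⌉₊ ⌊(x + H X) / d⌋₊).filter (lichtmanTypical X A δ (H X))) α‖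
          ≤ C * ((H X : ℝ) * X / ((d : ℝ) * Real.log X ^ A))

/-- NAMED FACT — **Proposition 2.3 in the regime `H ≤ exp((log X)^{2/3})`**: the statement
`Lichtman2020_keyFourierEstimateLiouville` (Prop 2.3 as printed, hypothesis "`ψ(X) ≤ (log X)^{2/3}`")
with that hypothesis replaced by the standing assumption "`H ≤ exp((log X)^{2/3})` hereafter" of
p. 8, which is stronger as a hypothesis (`exp((log X)^{2/3}) ≤ (log X)^{(log X)^{2/3}}` once
`log log X ≥ 1`), so that this fact is WEAKER than the printed one
(`Lichtman2020_keyFourierEstimateLiouville'_of_keyFourierEstimateLiouville`) — it is the form the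
circle method of §3 delivers (`Lichtman2020_keyFourierEstimateLiouville'_of_arcs`) and the form
the deduction of Theorem 2.2 consumes (`Lichtman2020_keyFourierEstimate_of_liouville'`).  As
there, `C` is chosen after the function `H` and may depend on it (weaker than `≪_{A,δ}`).
[cite: Lichtman2020, Proposition 2.3] -/
def Lichtman2020_keyFourierEstimateLiouville' : Prop :=
  ∀ A : ℝ, 5 < A → ∀ δ : ℝ, 0 < δ → ∀ H : ℕ → ℕ,
    Tendsto (fun X : ℕ => Real.log (H X) / Real.log (Real.log X)) atTop atTop →
    (∀ᶠ X : ℕ in atTop, (H X : ℝ) ≤ Real.exp (Real.log X ^ (2 / 3 : ℝ))) →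
    ∃ C : ℝ, ∀ᶠ X : ℕ in atTop, ∀ d : ℕ, 1 ≤ d → (d : ℝ) ≤ Real.log X ^ A → ∀ α : ℝ,
      ∫ x in (0 : ℝ)..X,
          ‖liouvilleTwistedSum
              ((Icc ⌈x / d⌉₊ ⌊(x + H X) / d⌋₊).filter (lichtmanTypical X A δ (H X))) α‖
        ≤ C * ((H X : ℝ) * X / ((d : ℝ) ^ (3 / 4 : ℝ) * Real.log X ^ (A / 5)))

namespace Lichtman2020

/-! ### Periodicity and the deduction of Proposition 2.3 -/

/-- `e(nα)` only depends on `α` modulo `1` (`n ∈ ℕ`; `e(m) = 1` for `m ∈ ℤ` is the tree's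
`Literature.NumberTheory.Sieve.RamanujanSum.fourierChar_intCast`). [folklore] -/
theorem fourierChar_natCast_mul_fract (n : ℕ) (α : ℝ) :
    (𝐞 ((n : ℝ) * Int.fract α) : ℂ) = 𝐞 ((n : ℝ) * α) := by
  have hα : (n : ℝ) * α = (n : ℝ) * Int.fract α + ((n * ⌊α⌋ : ℤ) : ℝ) := by
    rw [Int.fract]; push_cast; ring
  rw [hα, AddChar.map_add_eq_mul, Circle.coe_mul, RamanujanSum.fourierChar_intCast, mul_one]

/-- The twisted sum is `1`-periodic in `α`. [folklore] -/
theorem twistedSum_fract (g : ℕ → ℂ) (s : Finset ℕ) (α : ℝ) :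
    twistedSum g s (Int.fract α) = twistedSum g s α := by
  unfold twistedSum
  refine Finset.sum_congr rfl fun n _ => ?_
  rw [fourierChar_natCast_mul_fract]

/-- The Liouville twisted sum is the twisted sum of `λ`. [folklore] -/
theorem liouvilleTwistedSum_eq_twistedSum (s : Finset ℕ) (α : ℝ) :
    liouvilleTwistedSum s α =
      twistedSum (fun n => ((ArithmeticFunction.liouville n : ℤ) : ℂ)) s α := rfl

/-- The Liouville twisted sum is `1`-periodic in `α`. [folklore] -/
theorem liouvilleTwistedSum_fract (s : Finset ℕ) (α : ℝ) :
    liouvilleTwistedSum s (Int.fract α) = liouvilleTwistedSum s α := by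
  rw [liouvilleTwistedSum_eq_twistedSum, liouvilleTwistedSum_eq_twistedSum, twistedSum_fract]

end Lichtman2020

open Lichtman2020 in
/-- **Proposition 2.3 (regime `H ≤ exp((log X)^{2/3})`) from Propositions 3.1 and 3.2** (p. 9: "We
shall obtain Proposition 2.3 from the following results"): for `α ∈ ℝ` the integrand is `1`-periodic,
so `α` may be taken in `[0,1] = 𝔐 ∪ 𝔪`; on `𝔪` apply Proposition 3.1 with `g = λ` (completely
multiplicative, `|λ| ≤ 1`), on `𝔐` Proposition 3.2 and `HX/(dW) ≤ HX/(d^{3/4} W^{1/5})` (`d, W ≥ 1`).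
[cite: Lichtman2020, §3, p. 9] -/
theorem Lichtman2020_keyFourierEstimateLiouville'_of_arcs (h31 : Lichtman2020_minorArcEstimate)
    (h32 : Lichtman2020_majorArcEstimate) : Lichtman2020_keyFourierEstimateLiouville' := by
  intro A hA δ hδ H hH hHexp
  have hA0 : 0 < A := by linarith
  obtain ⟨C₁, hC₁⟩ := h31 A hA δ hδ.le H hH hHexp
  obtain ⟨C₂, hC₂⟩ := h32 A hA δ hδ H hH hHexp
  refine ⟨max (max C₁ C₂) 0, ?_⟩
  have hlog1 : ∀ᶠ X : ℕ in atTop, 1 ≤ Real.log X :=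
    (Real.tendsto_log_atTop.comp tendsto_natCast_atTop_atTop).eventually_ge_atTop 1
  filter_upwards [hC₁, hC₂, hlog1] with X h1 h2 hL1 d hd hdW α
  set C : ℝ := max (max C₁ C₂) 0 with hC
  have hC0 : 0 ≤ C := le_max_right _ _
  have hCC₁ : C₁ ≤ C := (le_max_left _ _).trans (le_max_left _ _)
  have hCC₂ : C₂ ≤ C := (le_max_right _ _).trans (le_max_left _ _)
  have hd1 : (1 : ℝ) ≤ d := by exact_mod_cast hd
  have hd0 : (0 : ℝ) < d := by linarith
  have hL0 : 0 < Real.log X := by linarith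
  have hden₁ : 0 < (d : ℝ) ^ (3 / 4 : ℝ) * Real.log X ^ (A / 5) :=
    mul_pos (Real.rpow_pos_of_pos hd0 _) (Real.rpow_pos_of_pos hL0 _)
  have hden₂ : 0 < (d : ℝ) * Real.log X ^ A := mul_pos hd0 (Real.rpow_pos_of_pos hL0 _)
  have hnum : 0 ≤ (H X : ℝ) * X := by positivity
  have hkey : (d : ℝ) ^ (3 / 4 : ℝ) * Real.log X ^ (A / 5) ≤ (d : ℝ) * Real.log X ^ A := by
    apply mul_le_mul _ _ (Real.rpow_nonneg hL0.le _) hd0.le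
    · calc (d : ℝ) ^ (3 / 4 : ℝ) ≤ (d : ℝ) ^ (1 : ℝ) :=
            Real.rpow_le_rpow_of_exponent_le hd1 (by norm_num)
        _ = d := Real.rpow_one _
    · exact Real.rpow_le_rpow_of_exponent_le hL1 (by linarith)
  -- reduce to `α' = fract α ∈ [0, 1]`
  have hper : ∫ x in (0 : ℝ)..X, ‖liouvilleTwistedSum
      ((Icc ⌈x / d⌉₊ ⌊(x + H X) / d⌋₊).filter (lichtmanTypical X A δ (H X))) α‖ =
      ∫ x in (0 : ℝ)..X, ‖liouvilleTwistedSum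
      ((Icc ⌈x / d⌉₊ ⌊(x + H X) / d⌋₊).filter (lichtmanTypical X A δ (H X))) (Int.fract α)‖ := by
    simp_rw [liouvilleTwistedSum_fract]
  rw [hper]
  have hmem : Int.fract α ∈ Set.Icc (0 : ℝ) 1 := ⟨Int.fract_nonneg α, (Int.fract_lt_one α).le⟩
  rcases mem_majorArcs_or_minorArcs (W := Real.log X ^ A)
      (Q₁ := (H X : ℝ) / Real.log X ^ (4 * A)) hmem with hM | hm
  · -- major arcs: Proposition 3.2
    have hb := h2 d hd hdW (Int.fract α) hM
    refine hb.trans ?_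
    calc C₂ * ((H X : ℝ) * X / ((d : ℝ) * Real.log X ^ A))
        ≤ C * ((H X : ℝ) * X / ((d : ℝ) * Real.log X ^ A)) :=
          mul_le_mul_of_nonneg_right hCC₂ (div_nonneg hnum hden₂.le)
      _ ≤ C * ((H X : ℝ) * X / ((d : ℝ) ^ (3 / 4 : ℝ) * Real.log X ^ (A / 5))) :=
          mul_le_mul_of_nonneg_left (div_le_div_of_nonneg_left hnum hden₁ hkey) hC0
  · -- minor arcs: Proposition 3.1 with `g = λ`
    have hg1 : (fun n : ℕ => ((ArithmeticFunction.liouville n : ℤ) : ℂ)) 1 = 1 := by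
      simp [ArithmeticFunction.liouville_apply_one]
    have hgmul : ∀ m n : ℕ, (fun n : ℕ => ((ArithmeticFunction.liouville n : ℤ) : ℂ)) (m * n) =
        (fun n : ℕ => ((ArithmeticFunction.liouville n : ℤ) : ℂ)) m *
          (fun n : ℕ => ((ArithmeticFunction.liouville n : ℤ) : ℂ)) n := by
      intro m n
      simp only [ArithmeticFunction.liouville_apply_mul, Int.cast_mul]
    have hgle : ∀ n : ℕ, ‖(fun n : ℕ => ((ArithmeticFunction.liouville n : ℤ) : ℂ)) n‖ ≤ 1 := by
      intro n
      simp only [Complex.norm_intCast]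
      exact_mod_cast abs_liouville_le_one n
    have hb := h1 d hd hdW _ hg1 hgmul hgle (Int.fract α) hm
    simp_rw [← liouvilleTwistedSum_eq_twistedSum] at hb
    exact hb.trans (mul_le_mul_of_nonneg_right hCC₁ (div_nonneg hnum hden₁.le))

open Lichtman2020 in
/-- The printed Proposition 2.3 implies its restriction to the regime `H ≤ exp((log X)^{2/3})`
(`log H ≤ (log X)^{2/3} ≤ (log X)^{2/3} log log X` once `log log X ≥ 1`). [cite: Lichtman2020, Proposition 2.3] -/
theorem Lichtman2020_keyFourierEstimateLiouville'_of_keyFourierEstimateLiouville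
    (h23 : Lichtman2020_keyFourierEstimateLiouville) : Lichtman2020_keyFourierEstimateLiouville' := by
  intro A hA δ hδ H hH hHexp
  have hone := eventually_one_le_H hH
  have hll : ∀ᶠ X : ℕ in atTop, 1 ≤ Real.log (Real.log X) :=
    (Real.tendsto_log_atTop.comp tendsto_log_natCast).eventually_ge_atTop 1
  have hψ : ∀ᶠ X : ℕ in atTop,
      Real.log (H X) / Real.log (Real.log X) ≤ Real.log X ^ (2 / 3 : ℝ) := by
    filter_upwards [hHexp, hone, hll, tendsto_log_natCast.eventually_ge_atTop 1] with X hX h1 h2 h3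
    have hH0 : (0 : ℝ) < H X := by exact_mod_cast h1
    have hlogH : Real.log (H X) ≤ Real.log X ^ (2 / 3 : ℝ) := by
      have := Real.log_le_log hH0 hX
      rwa [Real.log_exp] at this
    have hr0 : 0 ≤ Real.log X ^ (2 / 3 : ℝ) := Real.rpow_nonneg (by linarith) _
    rw [div_le_iff₀ (by linarith)]
    calc Real.log (H X) ≤ Real.log X ^ (2 / 3 : ℝ) := hlogH
      _ = Real.log X ^ (2 / 3 : ℝ) * 1 := (mul_one _).symm
      _ ≤ Real.log X ^ (2 / 3 : ℝ) * Real.log (Real.log X) := mul_le_mul_of_nonneg_left h2 hr0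
  exact h23 A hA δ hδ H hH hψ

open Lichtman2020 in
/-- **Theorem 2.2 from Proposition 2.3 in the regime `H ≤ exp((log X)^{2/3})`**: the deduction
`Lichtman2020_keyFourierEstimate_of_liouville` only ever invokes Proposition 2.3 for the `H` of
Theorem 2.2, which satisfies `H ≤ exp((log X)^{2/3})`; here is the same argument from the weaker
fact `Lichtman2020_keyFourierEstimateLiouville'`. [cite: Lichtman2020, Theorem 2.2 and Proposition 2.3] -/
theorem Lichtman2020_keyFourierEstimate_of_liouville'
    (h23 : Lichtman2020_keyFourierEstimateLiouville') : Lichtman2020_keyFourierEstimate := by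
  intro A hA δ hδ H hH hHexp
  have hA0 : 0 < A := by linarith
  have hone := eventually_one_le_H hH
  obtain ⟨C, hC⟩ := h23 A hA δ hδ H hH hHexp
  refine ⟨3 * max C 0 + 4, ?_⟩
  have hW4 : ∀ᶠ X : ℕ in atTop, 4 ≤ Real.log X ^ A :=
    ((tendsto_rpow_atTop hA0).comp tendsto_log_natCast).eventually_ge_atTop 4
  filter_upwards [hC, hHexp, hone, hW4, tendsto_log_natCast.eventually_gt_atTop 1,
    eventually_sqrtW_lt_P2 A δ hδ, eventually_gt_atTop 0] with X hCX hHX h1 hW4X hL1 hP2 hX0 α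
  have hX0' : (0 : ℝ) < X := by exact_mod_cast hX0
  have hL0 : 0 < Real.log X := by linarith
  set W : ℝ := Real.log X ^ A with hW
  have hW0 : 0 < W := by rw [hW]; exact Real.rpow_pos_of_pos hL0 _
  have hW15 : W ^ (1 / 5 : ℝ) = Real.log X ^ (A / 5) := by
    rw [hW, ← Real.rpow_mul hL0.le]; ring_nf
  have hHleX : H X ≤ X := by
    have h2 : Real.log X ^ (2 / 3 : ℝ) ≤ Real.log X := by
      calc Real.log X ^ (2 / 3 : ℝ) ≤ Real.log X ^ (1 : ℝ) :=
            Real.rpow_le_rpow_of_exponent_le hL1.le (by norm_num)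
        _ = Real.log X := Real.rpow_one _
    have h3 : (H X : ℝ) ≤ X := by
      calc (H X : ℝ) ≤ Real.exp (Real.log X ^ (2 / 3 : ℝ)) := hHX
        _ ≤ Real.exp (Real.log X) := Real.exp_le_exp.mpr h2
        _ = X := Real.exp_log hX0'
    exact_mod_cast h3
  rw [integral_window_eq_sum (fun s => ‖moebiusTwistedSum (s.filter (lichtmanTypical X A δ (H X))) α‖)
    X (H X) h1]
  set M : ℕ := ⌊Real.sqrt W⌋₊ with hM
  have hMle : (M : ℝ) ≤ Real.sqrt W := Nat.floor_le (Real.sqrt_nonneg _)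
  have hsqrtW : Real.sqrt W = Real.log X ^ (A / 2) := by
    rw [Real.sqrt_eq_rpow, hW, ← Real.rpow_mul hL0.le]; ring_nf
  have hS : ∀ d : ℕ, 1 ≤ d → d ≤ M → ∀ m : ℕ,
      lichtmanTypical X A δ (H X) (d ^ 2 * m) ↔ lichtmanTypical X A δ (H X) m := by
    intro d hd hdM m
    have hdW : (d : ℝ) ≤ Real.log X ^ (A / 2) := by
      rw [← hsqrtW]; exact le_trans (by exact_mod_cast hdM) hMle
    refine lichtmanTypical_sq_mul_iff hd (lt_of_le_of_lt hdW ?_) (lt_of_le_of_lt hdW hP2) m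
    exact Real.rpow_lt_rpow_of_exponent_lt hL1 (by linarith)
  have hP23 : ∀ e : ℕ, 1 ≤ e → (e : ℝ) ≤ W → ∀ β : ℝ,
      ∑ k ∈ Icc 1 X, ‖liouvilleTwistedSum ((windowDiv e (H X) k).filter
          (lichtmanTypical X A δ (H X))) β‖ ≤
        max C 0 * ((H X : ℝ) * X / ((e : ℝ) ^ (3 / 4 : ℝ) * W ^ (1 / 5 : ℝ))) := by
    intro e he heW β
    have h := hCX e he heW β
    rw [integral_window_div_eq_sum (fun s => ‖liouvilleTwistedSum (s.filter
      (lichtmanTypical X A δ (H X))) β‖) X (H X) e he] at h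
    rw [hW15]
    refine h.trans (mul_le_mul_of_nonneg_right (le_max_left _ _) ?_)
    have : 0 < (e : ℝ) ^ (3 / 4 : ℝ) := Real.rpow_pos_of_pos (by exact_mod_cast he) _
    positivity
  have hmain := keyFourier_fixed_bound (lichtmanTypical X A δ (H X)) α h1 hHleX hW4X hM le_rfl
    (le_max_right C 0) hP23 hS
  rw [hW15] at hmain
  exact hmain

open Lichtman2020 in
/-- **Lichtman's Theorem 1.1 (qualitative part) from Propositions 3.1 and 3.2 (and the sieve bound
(2.5))** — the state of the decomposition after this file: minor arcs + major arcs ⟹ Prop 2.3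
(regime) ⟹ Thm 2.2 ⟹ (with (2.5)) Thm 1.1.  The hypothesis `h25` is discharged by
`Lichtman2020_shiftedPrimeSieveBound_holds` (`MoebiusShiftedPrimesSieveBound.lean`, not imported here).
[cite: Lichtman2020, Theorem 1.1] -/
theorem lichtman2020_moebius_shifted_primes_avg_of_arcs (h31 : Lichtman2020_minorArcEstimate)
    (h32 : Lichtman2020_majorArcEstimate) (h25 : Lichtman2020_shiftedPrimeSieveBound) :
    lichtman2020_moebius_shifted_primes_avg :=
  lichtman2020_moebius_shifted_primes_avg_of_keyFourierEstimate
    (Lichtman2020_keyFourierEstimate_of_liouville'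
      (Lichtman2020_keyFourierEstimateLiouville'_of_arcs h31 h32)) h25

end Literature.NumberTheory.Sieve
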